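import Summits.QuantumFields.YangMills.Theorems.BalabanUVNodesN18KingModelScales
import Literature.MathematicalPhysics.QuantumFieldTheory.King1986.MinimizerBlockDecay

/-!
# BalabanUVNodes ∕ N18 — King's (3.73) = (4.42)–(4.43), FIRST BOUND, `j ≥ 1`, FOR KING'S ACTUAL OPERATORS ON BAŁABAN'S
# TORI, UNCONDITIONAL: the outer-line binders of `N18KingModelScales.ne5_of_threeFactorRates_lemma45` DISCHARGED BY NAME
# by n18-b's `King1986/MinimizerBlockDecay` ⟹ a MULTI-SCALE inhabitant of `T4OutputRate.NE5` with `θ = L^{−γ∕2} < 1`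
# and `κ > 0`, every binder a READ-OUT FORMULA (Track A, DAG node N18 = NE5 `T4OutputRate.NE5 EA EB W κ θ C₅` :211;
# cluster K4; the -a∕-b loop on the PRINTED MODEL, fourth display)

HONEST FRAMING.  Count-neutral kernel bookkeeping (seat pub-ymgap-dag-n18-a g4; `--supports stmt-QuantumFields-19182`).
King's A = 0 scalar MODEL of the NE5 mechanism (template literature, published and proved) — NOT Bałaban's covariant
one-step outputs `E^{(j)}(X; g, U)` ((2.13) of [Balaban1987RG1]), for which NE5 is NOT IN PRINT and has no tree producer
(NODE O 0∕1); NOT a node discharge; finite tori; nothing continuum ∕ ℝ⁴ ∕ OS ∕ mass-gap ∕ Clay.  THEOREMS ONLY: 0 `def`,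
0 `sorry`, standard axioms.

THE POINT.  `N18KingModelScales.ne5_of_threeFactorRates_lemma45` (p415038) knits King's p. 675 assembly — «we have the
expansion G^{(j)}_{k+n}(x′, y′) = Σ_{z,w} a_{j+n}G^{η′}_{j+n}Q^*_{j+n}(x′, z) C^{(j+n),L^j}(z, w) a_{j+n}Q_{j+n}G^{η′}_{j+n}(w, y′)
(4.42) … we now replace … using Proposition 3.8 … the error from this replacement is bounded by (4.43) … Clearly we can
replace … and bound the error in the same way» — into `NE5` with the MIDDLE line (Lemma 4.5, (4.33)–(4.34)) discharged on the
torus and ONLY the OUTER lines (Prop. 3.8 (3.71) line 1 rows∕columns with Theorem 3.3 decay, torus-distance currency) left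
as binders `hu`, `hv`, `hdu`, `hdv`; its header pinned «the dictionary from n18-b's `king_prop38_torus_printed` (tower-label
currency) to §3's outer-line binders (tdist currency)» as NOT COVERED.  Seat n18-b's eighth file `MinimizerBlockDecay`
(p416071) IS that dictionary: `minimiser_row_decay` ∕ `minimiser_col_decay` (Theorem 3.3 ∕ Prop. 3.7 (3.64) for King's
ACTUAL `ℋ_K = a_KG^η_KQ^*_K` in the unit-torus distance from the BLOCK of the fine point, every Bałaban volume, no label
hypotheses) and `minimiser_row_rate` ((3.71) line 1 likewise, rate `√(2ac₀(C₁(K,n)+C₂)(L^K)^{−γ})`).  This file composes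
the two BY NAME:
* §1 `outerRate_le_unif` — the outer rate constant made uniform in `K, n` (`N18KingModel.prop38Const_le_unif`,
  `(L^K)^{−γ} = ((L^{−γ∕2})^K)²`): `√((C₁(K,n)+C₂)(L^K)^{−γ}·2ac₀) ≤ √(2ac₀C₅(a,L,d,γ))·(L^{−γ∕2})^K`.
* §2 **`ne5_kingModel_threeFactor_torus`** — for `d ≥ 1`, odd `L ≥ 3`, `a > 0`, `m² > 0`, `0 ≤ γ ≤ 1` there are `κ > 0`
  and `C₅ ≥ 0` (functions of `d, L, a, m², γ` ONLY) such that for EVERY `n ≥ 1`, EVERY scale-indexed family of Bałaban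
  unit tori `L·M_j(μ) = 2L^{m_j}` (the unit lattice of step `j` of a run on the physical torus of side `2L^{m_j}`; King's
  `Ω`), EVERY carriers `C` with creation scales `j = scale X ≥ 1` whose domains read two fine points `x_A(X)`, `y_A(X)`
  of run A's torus (`L^j` points per unit side) UNDER run B's `x_B(X)`, `y_B(X)` (`L^nL^j` points) and a tree length
  `d X ≤ |B(x_A) − B(y_A)|_{T₁}`, and EVERY pair of functionals reading the (4.42) three-factor graphs
  `EA g U X = Σ_{z,w} ℋ_j(x_A, z)·C^{(j)}(z, w)·ℋ_j(y_A, w)`, `EB g U X = Σ_{z,w} ℋ_{j+n}(x_B, z)·C^{(j+n)}(z, w)·ℋ_{j+n}(y_B, w)`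
  (King's ACTUAL operators: `ℋ = minimiser`, `C^{(·)} = (effLaplacian + aL⁻²·blockProj)⁻¹` of the tree), every window:
  **`NE5 EA EB W κ (L^{−γ∕2}) C₅`** — (3.73)'s first bound for `j ≥ 1`, ONE `θ` for ALL scales, `θ < 1` iff `γ > 0`
  (`N18KingModel.kingTheta_lt_one`), `κ > 0`; no analytic binder left (`ne5_kingModel_threeFactor_letters`).
* §3 `ne5_kingModel_threeFactor_inhabited` — §2 on King's own LITERAL carriers (domains = a scale and two run-B fine
  points, `d X` = the actual block distance `|B(x_A) − B(y_A)|_{T₁}`, trivial backgrounds): §2's read-out binders are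
  jointly satisfiable with a non-idle decay factor (`hx`, `hy` ≔ `coarse_val`, `hd` ≔ `le_rfl`, `hEA`, `hEB` ≔ `rfl`).
Inputs BY NAME: `ne5_of_threeFactorRates_lemma45` (at `γ∕2`; inside: `king_cov_decay_torus`, `king_lemma45_torus`,
`tdistT_sumBound`, `bilin3_rate`), `minimiser_row_decay`, `minimiser_col_decay`, `minimiser_row_rate`, `blockOf_over`,
`prop38Const_le_unif`, `coarse_val`.
NOT COVERED ∕ PINS (standing, ref-B READ #66∕#73∕#110): A = 0, `g`∕`U` unread (no running coupling, no background);
periodic b.c.; the `j = 0` piece of (3.73) (Prop. 3.7, «When j = 0, we bound each term separately»); King's rescaling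
(2.20) to the `L^jη`-lattice and the factor `(L^jη)^{2−d−γ}` (we stay on the unit lattice of scale `j`); the derivative
∕ Hölder bounds of (3.73); vertex functions at `z`, `w`; the bearing on Bałaban's `E^{(j)}(X; g, U)` is NIL (NODE O + rows
NE2∕NE3, seat README «No tree producer»).

Sources: C. King, Commun. Math. Phys. **102** (1986) 649–677 [King1986] — Prop. 3.9 (3.73) p. 665, (4.42)–(4.43)
p. 675, Prop. 3.8 (3.71) p. 664, Lemma 4.5 (4.38) p. 674, Thm 3.3 (3.7) p. 658, Prop. 3.7 (3.64) p. 663; T. Bałaban,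
Commun. Math. Phys. **89** (1983) 571–597 [Balaban1983RegularityDecay] Thm (1.10) p. 573 (the decay input, via n18-b's
chain); T. Bałaban, Commun. Math. Phys. **109** (1987) 249–301 [Balaban1987RG1] — (0.24)–(0.25) p. 257, Thm 1 p. 259
(uniformity in ε, the only printed trace of NE5).  No claim about the mass gap.
-/

noncomputable section

namespace Summit.QuantumFields.YangMills.BalabanUVNodes.N18KingModelTorus

open Real Matrix
open Literature.MathematicalPhysics.QuantumFieldTheory.Balaban1983to89 (Params)
open Literature.MathematicalPhysics.QuantumFieldTheory.Balaban1983to89.T4OutputRate (Carriers Functional NE5)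
open Literature.MathematicalPhysics.QuantumFieldTheory.Balaban1983to89.B5Prop11Plancherel (Tor fine)
open Literature.MathematicalPhysics.QuantumFieldTheory.Balaban1983to89.B4Sect5Proof (latticeConst latticeConst_nonneg)
open Literature.MathematicalPhysics.QuantumFieldTheory.King1986
  (aK lemma43Const prop38RateConst prop38PosConst)
open Literature.MathematicalPhysics.QuantumFieldTheory.King1986.Torus
  (minimiser effLaplacian blockProj blockOf blockOf_over tdistT tdistT_symm tdistT_nonneg K45 K45_nonneg delta45 gam0L gam0L_pos
    delta45_pos minimiser_row_decay minimiser_col_decay minimiser_row_rate)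
open Summit.QuantumFields.YangMills.BalabanUVNodes.N18KingModel
  (prop38Const_le_unif prop38Const_unif_nonneg rpow_neg_natPow kingTheta_pos kingTheta_lt_one kingTheta_eq_sq
    sqrt_mul_sq_mul coarse_val)
open Summit.QuantumFields.YangMills.BalabanUVNodes.N18KingModelScales (ne5_of_threeFactorRates_lemma45)

variable {d : ℕ}

/-! ## §1 The outer-line rate constant, uniform in `K` and `n` -/

/-- **One outer rate constant for all scales.**  n18-b's (3.71)-line-1 constant `√((C₁(K,n) + C₂)·(L^K)^{−γ}·2ac₀)`
(`minimiser_row_rate`) is at most `√(2ac₀·C₅(a, L, d, γ))·(L^{−γ∕2})^K` with the `K, n`-free `C₅(a,L,d,γ)` of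
`N18KingModel.prop38Const_le_unif` (`(L^K)^{−γ} = ((L^{−γ∕2})^K)²`). [cite: King1986, Prop. 3.8 (3.71) p.664, Lemma 4.3 p.672] -/
theorem outerRate_le_unif (hd : 0 < d) {a : ℝ} (ha : 0 < a) {L : ℕ} (hL : 2 ≤ L) {K n : ℕ} (hK : 1 ≤ K) (hn : 1 ≤ n)
    {γ : ℝ} (hγ1 : γ ≤ 1) {c₀ : ℝ} (hc₀ : 0 ≤ c₀) :
    Real.sqrt ((prop38RateConst a a (lemma43Const a L K n) ((π ^ 2 / 4) ^ d) d γ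
          + prop38PosConst a ((π ^ 2 / 4) ^ d) d γ) * ((L ^ K : ℕ) : ℝ) ^ (-γ) * (2 * (a * c₀)))
      ≤ Real.sqrt (2 * (a * c₀) *
            (prop38RateConst a a (a * (2 * ((a * (1 - ((L : ℝ) ^ 2)⁻¹))⁻¹ + π ^ 2 / 48 + 1 / 3)))
                ((π ^ 2 / 4) ^ d) d γ
              + prop38PosConst a ((π ^ 2 / 4) ^ d) d γ))
          * (((L : ℝ) ^ (-(γ / 2))) ^ K) := by
  set s : ℝ := (L : ℝ) ^ (-(γ / 2)) with hs_def
  have hs : 0 ≤ s := Real.rpow_nonneg (Nat.cast_nonneg _) _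
  have hrate : ((L ^ K : ℕ) : ℝ) ^ (-γ) = (s ^ K) ^ 2 := by
    rw [rpow_neg_natPow, kingTheta_eq_sq, ← pow_mul, ← pow_mul, mul_comm]
  set Ck : ℝ := prop38RateConst a a (lemma43Const a L K n) ((π ^ 2 / 4) ^ d) d γ
    + prop38PosConst a ((π ^ 2 / 4) ^ d) d γ with hCk
  set Cu : ℝ := prop38RateConst a a (a * (2 * ((a * (1 - ((L : ℝ) ^ 2)⁻¹))⁻¹ + π ^ 2 / 48 + 1 / 3)))
      ((π ^ 2 / 4) ^ d) d γ + prop38PosConst a ((π ^ 2 / 4) ^ d) d γ with hCu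
  have hCle : Ck ≤ Cu := prop38Const_le_unif hd ha hL hK hn (by linarith)
  rw [hrate, sqrt_mul_sq_mul (pow_nonneg hs _)]
  have hmono : Real.sqrt (Ck * (2 * (a * c₀))) ≤ Real.sqrt (2 * (a * c₀) * Cu) := by
    rw [mul_comm Ck]
    exact Real.sqrt_le_sqrt (mul_le_mul_of_nonneg_left hCle (by positivity))
  exact mul_le_mul_of_nonneg_right hmono (pow_nonneg hs _)

/-! ## §2 (3.73), first bound, `j ≥ 1`, on Bałaban's tori: every outer line BY NAME -/

/-- **KING'S (3.73) = (4.42)–(4.43), FIRST BOUND, `j ≥ 1`, AS A MULTI-SCALE INHABITANT OF N18's DECL OF RECORD —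
UNCONDITIONAL FOR KING'S ACTUAL OPERATORS ON BAŁABAN'S TORI.**  For `d ≥ 1`, odd `L > 1`, `a > 0`, `m² > 0`, `0 ≤ γ ≤ 1`
there are `κ > 0`, `C₅ ≥ 0` (functions of `d, L, a, m², γ` only) such that: for every `n ≥ 1`; every scale-indexed
family of unit tori `Π_μ ℤ∕(L·M_j(μ))` with `L·M_j(μ) = 2L^{m_j}` (the unit lattice `T₁` of a Bałaban volume
`(d, L, m_j, j)`, King's `Ω`); every carriers `C` with `1 ≤ scale X` whose domain `X` of scale `j` reads fine points
`x_A(X)`, `y_A(X) ∈ T_η` (`η = L^{−j}`: `L^j` points per unit side) UNDER `x_B(X)`, `y_B(X) ∈ T_{η′}` (`η′ = L^{−j−n}`;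
King: «we denote by x that point in T_η for which x′ ∈ B^n(x)») and whose tree length is at most the unit-torus distance
of the blocks `|B(x_A) − B(y_A)|_{T₁}`; every two functionals reading the (4.42) three-factor graphs — run A
`Σ_{z,w} ℋ_j(x_A, z)·C^{(j)}(z, w)·ℋ_j(y_A, w)`, run B `Σ_{z,w} ℋ_{j+n}(x_B, z)·C^{(j+n)}(z, w)·ℋ_{j+n}(y_B, w)` with King's
ACTUAL `A = 0` operators of the tree (`ℋ_K = minimiser (L^K) T₁ a_K L^{2K} m²`, `C^{(K)} = (effLaplacian (L^K) T₁ a_K L^{2K} m²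
+ aL⁻²·blockProj)⁻¹`) — neither reading the couplings nor the backgrounds; and every window `W`:
`NE5 EA EB W κ (L^{−γ∕2}) C₅`, i.e. `|EA − EB| ≤ C₅·(L^{−γ∕2})^{scale X}·e^{−κ·d X}` at EVERY domain, ONE `θ = L^{−γ∕2}` for
ALL scales (`< 1` iff `γ > 0`).  Composition: `ne5_of_threeFactorRates_lemma45` at `γ∕2` (middle line: `king_lemma45_torus`,
`king_cov_decay_torus`, `tdistT_sumBound`) with `hu` ≔ `minimiser_row_decay`, `hv` ≔ `minimiser_col_decay` ∘ `blockOf_over`,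
`hdu`, `hdv` ≔ `minimiser_row_rate` ∘ `outerRate_le_unif` (∘ `tdistT_symm`), at the common rate
`κ = min(δ₀^{row}, δ₀^{col}, δ₀^{rate}∕2, δ₄₅)`.  A = 0 MODEL; periodic b.c.; `j = 0`, (2.20)-rescaling, derivative lines
outside. [cite: King1986, Prop. 3.9 (3.73) p.665, (4.42)–(4.43) p.675, Prop. 3.8 (3.71) p.664, Lemma 4.5 (4.38) p.674, Thm 3.3 p.658] -/
theorem ne5_kingModel_threeFactor_torus (hd : 1 ≤ d) (L : ℕ) [NeZero L] (hLp : Odd L ∧ 1 < L) {a m2 : ℝ}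
    (ha : 0 < a) (hm : 0 < m2) {γ : ℝ} (hγ0 : 0 ≤ γ) (hγ1 : γ ≤ 1) :
    ∃ κ C₅ : ℝ, 0 < κ ∧ 0 ≤ C₅ ∧
      ∀ (n : ℕ) (_hn : 1 ≤ n) (M : ℕ → Fin d → ℕ) [∀ j μ, NeZero (M j μ)]
        (_hM : ∀ j, ∃ mm : ℕ, ∀ μ, L * M j μ = 2 * L ^ mm)
        (C : Carriers) (_hsc : ∀ X, 1 ≤ C.scale X)
        (xA yA : (X : C.Dom) → Tor (fine (L ^ C.scale X) (fine L (M (C.scale X)))))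
        (xB yB : (X : C.Dom) → Tor (fine (L ^ n * L ^ C.scale X) (fine L (M (C.scale X)))))
        (_hx : ∀ X μ, (xA X μ).val = (xB X μ).val / L ^ n)
        (_hy : ∀ X μ, (yA X μ).val = (yB X μ).val / L ^ n)
        (_hd : ∀ X, C.d X ≤ tdistT (fine L (M (C.scale X)))
            (blockOf (L ^ C.scale X) (fine L (M (C.scale X))) (xA X))
            (blockOf (L ^ C.scale X) (fine L (M (C.scale X))) (yA X)))
        (EA : Functional C C.BgA) (EB : Functional C C.BgB)
        (_hEA : ∀ g U X, EA g U X =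
          (fun z => minimiser (L ^ C.scale X) (fine L (M (C.scale X))) (aK a L (C.scale X))
              (((L ^ C.scale X : ℕ) : ℝ) ^ 2) m2 (Pi.single z 1) (xA X))
            ⬝ᵥ ((effLaplacian (L ^ C.scale X) (fine L (M (C.scale X))) (aK a L (C.scale X))
                    (((L ^ C.scale X : ℕ) : ℝ) ^ 2) m2
                  + (a * ((L : ℝ) ^ 2)⁻¹) • blockProj L (M (C.scale X)))⁻¹
                *ᵥ fun w => minimiser (L ^ C.scale X) (fine L (M (C.scale X))) (aK a L (C.scale X))
                    (((L ^ C.scale X : ℕ) : ℝ) ^ 2) m2 (Pi.single w 1) (yA X)))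
        (_hEB : ∀ g U X, EB g U X =
          (fun z => minimiser (L ^ n * L ^ C.scale X) (fine L (M (C.scale X))) (aK a L (C.scale X + n))
              (((L ^ n * L ^ C.scale X : ℕ) : ℝ) ^ 2) m2 (Pi.single z 1) (xB X))
            ⬝ᵥ ((effLaplacian (L ^ n * L ^ C.scale X) (fine L (M (C.scale X))) (aK a L (C.scale X + n))
                    (((L ^ n * L ^ C.scale X : ℕ) : ℝ) ^ 2) m2
                  + (a * ((L : ℝ) ^ 2)⁻¹) • blockProj L (M (C.scale X)))⁻¹
                *ᵥ fun w => minimiser (L ^ n * L ^ C.scale X) (fine L (M (C.scale X))) (aK a L (C.scale X + n))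
                    (((L ^ n * L ^ C.scale X : ℕ) : ℝ) ^ 2) m2 (Pi.single w 1) (yB X)))
        (W : Set (ℕ → ℝ)),
        NE5 EA EB W κ ((L : ℝ) ^ (-(γ / 2))) C₅ := by
  have hd0 : 0 < d := hd
  have hL2 : 2 ≤ L := by have := hLp.2; omega
  -- the three outer-line packages of n18-b (Theorem 3.3 ∕ (3.71) line 1 in block-distance currency), BY NAME
  obtain ⟨δ₁, c₁, hδ₁, hc₁, H₁⟩ := minimiser_row_decay d L hd hLp ha hm.le
  obtain ⟨δ₂, c₂, hδ₂, hc₂, H₂⟩ := minimiser_col_decay d L hd hLp ha hm.le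
  obtain ⟨δ₃, c₃, hδ₃, hc₃, H₃⟩ := minimiser_row_rate d L hd hLp.1 hL2 ha hm hγ0 hγ1
  -- one common decay rate for the four outer lines and the middle line
  have hδ45 : 0 < delta45 d a L := delta45_pos (d := d) ha hL2
  set κ : ℝ := min (min (min δ₁ δ₂) (δ₃ / 2)) (delta45 d a L) with hκ_def
  have hκpos : 0 < κ := lt_min (lt_min (lt_min hδ₁ hδ₂) (half_pos hδ₃)) hδ45
  have hκ₁ : κ ≤ δ₁ := (min_le_left _ _).trans ((min_le_left _ _).trans (min_le_left _ _))
  have hκ₂ : κ ≤ δ₂ := (min_le_left _ _).trans ((min_le_left _ _).trans (min_le_right _ _))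
  have hκ₃ : κ ≤ δ₃ / 2 := (min_le_left _ _).trans (min_le_right _ _)
  have hκ45 : κ ≤ delta45 d a L := min_le_right _ _
  -- the uniform letters
  set Cu : ℝ := prop38RateConst a a (a * (2 * ((a * (1 - ((L : ℝ) ^ 2)⁻¹))⁻¹ + π ^ 2 / 48 + 1 / 3)))
      ((π ^ 2 / 4) ^ d) d γ + prop38PosConst a ((π ^ 2 / 4) ^ d) d γ with hCu
  set cR : ℝ := Real.sqrt (2 * (a * c₃) * Cu) with hcR
  have hcR0 : 0 ≤ cR := Real.sqrt_nonneg _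
  have hsA : 0 ≤ a * c₁ := by positivity
  have hsB : 0 ≤ a * c₂ := by positivity
  have hγ₀ : 0 < gam0L d a L := gam0L_pos ha hL2
  have hK45 : 0 ≤ K45 d a L := K45_nonneg a L
  have hKd : 0 ≤ latticeConst d (κ / 2) := latticeConst_nonneg d (half_pos hκpos).le
  refine ⟨κ / 2, (cR * (2 / gam0L d a L) * (a * c₂) + a * c₁ * K45 d a L * (a * c₂)
      + a * c₁ * (2 / gam0L d a L) * cR) * (latticeConst d (κ / 2)) ^ 2, half_pos hκpos, by positivity, ?_⟩
  intro n hn M _ hM C hsc xA yA xB yB hx hy hdd EA EB hEA hEB W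
  have hγ1' : γ / 2 ≤ 1 := by linarith
  refine ne5_of_threeFactorRates_lemma45 (C := C) (EA := EA) (EB := EB) (W := W) L hL2 ha hm hn M hγ1' hsc
    (fun X => blockOf (L ^ C.scale X) (fine L (M (C.scale X))) (xA X))
    (fun X => blockOf (L ^ C.scale X) (fine L (M (C.scale X))) (yA X))
    (fun X z => minimiser (L ^ C.scale X) (fine L (M (C.scale X))) (aK a L (C.scale X))
      (((L ^ C.scale X : ℕ) : ℝ) ^ 2) m2 (Pi.single z 1) (xA X))
    (fun X z => minimiser (L ^ n * L ^ C.scale X) (fine L (M (C.scale X))) (aK a L (C.scale X + n))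
      (((L ^ n * L ^ C.scale X : ℕ) : ℝ) ^ 2) m2 (Pi.single z 1) (xB X))
    (fun X w => minimiser (L ^ C.scale X) (fine L (M (C.scale X))) (aK a L (C.scale X))
      (((L ^ C.scale X : ℕ) : ℝ) ^ 2) m2 (Pi.single w 1) (yA X))
    (fun X w => minimiser (L ^ n * L ^ C.scale X) (fine L (M (C.scale X))) (aK a L (C.scale X + n))
      (((L ^ n * L ^ C.scale X : ℕ) : ℝ) ^ 2) m2 (Pi.single w 1) (yB X))
    (fun X => (effLaplacian (L ^ C.scale X) (fine L (M (C.scale X))) (aK a L (C.scale X))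
        (((L ^ C.scale X : ℕ) : ℝ) ^ 2) m2 + (a * ((L : ℝ) ^ 2)⁻¹) • blockProj L (M (C.scale X)))⁻¹)
    (fun X => (effLaplacian (L ^ n * L ^ C.scale X) (fine L (M (C.scale X))) (aK a L (C.scale X + n))
        (((L ^ n * L ^ C.scale X : ℕ) : ℝ) ^ 2) m2 + (a * ((L : ℝ) ^ 2)⁻¹) • blockProj L (M (C.scale X)))⁻¹)
    (fun _ => rfl) (fun _ => rfl) hκpos hκ45 hsA hsB hcR0 hcR0 ?_ ?_ ?_ ?_ hdd hEA hEB
  · -- `hu`: run A's row, Theorem 3.3 in block-distance currency (`minimiser_row_decay`, volume `(d, L, m_j, j)`)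
    intro X z
    obtain ⟨mm, hmm⟩ := hM (C.scale X)
    have hMK : ∀ μ, fine L (M (C.scale X)) μ
        = (⟨d, L, mm, C.scale X, hd, hLp⟩ : Params).sitesPerDir (C.scale X) := fun μ => by
      simp only [Params.sitesPerDir, Nat.add_sub_cancel]; exact hmm μ
    exact H₁ ⟨d, L, mm, C.scale X, hd, hLp⟩ rfl rfl (hsc X) (fine L (M (C.scale X))) hMK (L ^ C.scale X) rfl
      κ hκpos hκ₁ (xA X) z
  · -- `hv`: run B's column (`minimiser_col_decay`, volume `(d, L, m_j, j + n)`), the block under `y_B` is `B(y_A)`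
    intro X w
    obtain ⟨mm, hmm⟩ := hM (C.scale X)
    have hMK : ∀ μ, fine L (M (C.scale X)) μ
        = (⟨d, L, mm, C.scale X + n, hd, hLp⟩ : Params).sitesPerDir (C.scale X + n) := fun μ => by
      simp only [Params.sitesPerDir, Nat.add_sub_cancel]; exact hmm μ
    have hN : L ^ n * L ^ C.scale X = L ^ (C.scale X + n) := by rw [pow_add, mul_comm]
    have h := H₂ ⟨d, L, mm, C.scale X + n, hd, hLp⟩ rfl rfl (show 1 ≤ C.scale X + n by have := hsc X; omega)
      (fine L (M (C.scale X))) hMK (L ^ n * L ^ C.scale X) hN κ hκpos hκ₂ (yB X) w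
    rw [blockOf_over (fine L (M (C.scale X))) (yA X) (yB X) (hy X)] at h
    exact h
  · -- `hdu`: the row difference, (3.71) line 1 in block-distance currency (`minimiser_row_rate`) + `outerRate_le_unif`
    intro X z
    obtain ⟨mm, hmm⟩ := hM (C.scale X)
    have hMK : ∀ μ, fine L (M (C.scale X)) μ
        = (⟨d, L, mm, C.scale X, hd, hLp⟩ : Params).sitesPerDir (C.scale X) := fun μ => by
      simp only [Params.sitesPerDir, Nat.add_sub_cancel]; exact hmm μ
    haveI : NeZero (⟨d, L, mm, C.scale X, hd, hLp⟩ : Params).L := ‹NeZero L›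
    have h := H₃ ⟨d, L, mm, C.scale X, hd, hLp⟩ rfl rfl (hsc X) n hn (fine L (M (C.scale X))) hMK κ hκpos hκ₃
      (xA X) (xB X) z (hx X)
    exact h.trans (mul_le_mul_of_nonneg_right (outerRate_le_unif hd0 ha hL2 (hsc X) hn hγ1 hc₃.le)
      (Real.exp_pos _).le)
  · -- `hdv`: the column difference, by symmetry of the torus distance
    intro X w
    obtain ⟨mm, hmm⟩ := hM (C.scale X)
    have hMK : ∀ μ, fine L (M (C.scale X)) μ
        = (⟨d, L, mm, C.scale X, hd, hLp⟩ : Params).sitesPerDir (C.scale X) := fun μ => by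
      simp only [Params.sitesPerDir, Nat.add_sub_cancel]; exact hmm μ
    haveI : NeZero (⟨d, L, mm, C.scale X, hd, hLp⟩ : Params).L := ‹NeZero L›
    have h := H₃ ⟨d, L, mm, C.scale X, hd, hLp⟩ rfl rfl (hsc X) n hn (fine L (M (C.scale X))) hMK κ hκpos hκ₃
      (yA X) (yB X) w (hy X)
    rw [tdistT_symm (fine L (M (C.scale X))) w]
    exact h.trans (mul_le_mul_of_nonneg_right (outerRate_le_unif hd0 ha hL2 (hsc X) hn hγ1 hc₃.le)
      (Real.exp_pos _).le)

/-- The letters of §2 have CONTENT: `κ > 0` is delivered by the theorem, and for `γ > 0` the rate `L^{−γ∕2}` lies in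
`]0, 1[` — a decay exponent AND a rate `< 1` for King's actual three-factor graphs with NO analytic binder, which one-run
envelopes alone never give (`BalabanUVNodesN18End.ne5_of_decayBounds_one_le` needs `θ ≥ 1`). [cite: King1986, Prop. 3.9 (3.73) p.665] -/
theorem ne5_kingModel_threeFactor_letters {L : ℕ} (hL : 2 ≤ L) {γ : ℝ} (hγ : 0 < γ) :
    0 < (L : ℝ) ^ (-(γ / 2)) ∧ (L : ℝ) ^ (-(γ / 2)) < 1 :=
  ⟨kingTheta_pos (by omega) _, kingTheta_lt_one hL (half_pos hγ)⟩

/-! ## §3 A LITERAL inhabitant: the three-factor graphs on King's own carriers (§2's read-out binders are jointly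
satisfiable with a NON-TRIVIAL tree length) -/

/-- **§2 INHABITED IN THE KERNEL WITH `d X` = THE ACTUAL BLOCK DISTANCE.**  On the LITERAL carriers whose domains are a
scale `j` (creation scale `j + 1`) together with a pair of run-B fine points `x′, y′ ∈ T_{η′}` (`η′ = L^{−j−1−n}`), with
tree length `d X := |B(x) − B(y)|_{T₁}` for the run-A points `x`, `y` under `x′`, `y′` (King: «that point in T_η for
which x′ ∈ B^n(x)»), trivial backgrounds, transport `id`, gauge `0`, the two functionals reading the (4.42) three-factor
graphs of run A at `(x, y)` and of run B at `(x′, y′)` satisfy `NE5 … κ (L^{−γ∕2}) C₅` with §2's letters, for EVERY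
`n ≥ 1`, every Bałaban unit torus `L·M′(μ) = 2L^{m}` (constant in the scale) and every window — §2 with `hx`, `hy` ≔
`N18KingModel.coarse_val`, `hd` ≔ `le_rfl`, `hEA`, `hEB` ≔ `rfl`: the binders of §2 are jointly satisfiable and the
decay factor is not idle. [cite: King1986, Prop. 3.9 (3.73) p.665, (4.42) p.675] -/
theorem ne5_kingModel_threeFactor_inhabited (hd : 1 ≤ d) (L : ℕ) [NeZero L] (hLp : Odd L ∧ 1 < L) {a m2 : ℝ}
    (ha : 0 < a) (hm : 0 < m2) {γ : ℝ} (hγ0 : 0 ≤ γ) (hγ1 : γ ≤ 1) :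
    ∃ κ C₅ : ℝ, 0 < κ ∧ 0 ≤ C₅ ∧
      ∀ (n : ℕ) (_hn : 1 ≤ n) (M' : Fin d → ℕ) [∀ μ, NeZero (M' μ)] (_hM' : ∃ mm : ℕ, ∀ μ, L * M' μ = 2 * L ^ mm)
        (W : Set (ℕ → ℝ)),
        NE5 (C := { Dom := Σ j : ℕ, Tor (fine (L ^ n * L ^ (j + 1)) (fine L M'))
                                  × Tor (fine (L ^ n * L ^ (j + 1)) (fine L M')),
                    scale := fun X => X.1 + 1,
                    d := fun X => tdistT (fine L M')
                      (blockOf (L ^ (X.1 + 1)) (fine L M')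
                        (fun μ => (((X.2.1 μ).val / L ^ n : ℕ) : ZMod (fine (L ^ (X.1 + 1)) (fine L M') μ))))
                      (blockOf (L ^ (X.1 + 1)) (fine L M')
                        (fun μ => (((X.2.2 μ).val / L ^ n : ℕ) : ZMod (fine (L ^ (X.1 + 1)) (fine L M') μ)))),
                    d_nonneg := fun _ => tdistT_nonneg _ _ _,
                    BgA := PUnit, BgB := PUnit, gauge := fun _ _ => 0, gauge_nonneg := fun _ _ => le_rfl,
                    transport := id })
          (fun (_ : ℕ → ℝ) (_ : PUnit)
              (X : Σ j : ℕ, Tor (fine (L ^ n * L ^ (j + 1)) (fine L M')) × Tor (fine (L ^ n * L ^ (j + 1)) (fine L M'))) =>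
            (fun z => minimiser (L ^ (X.1 + 1)) (fine L M') (aK a L (X.1 + 1)) (((L ^ (X.1 + 1) : ℕ) : ℝ) ^ 2) m2
                (Pi.single z 1) (fun μ => (((X.2.1 μ).val / L ^ n : ℕ) : ZMod (fine (L ^ (X.1 + 1)) (fine L M') μ))))
              ⬝ᵥ ((effLaplacian (L ^ (X.1 + 1)) (fine L M') (aK a L (X.1 + 1)) (((L ^ (X.1 + 1) : ℕ) : ℝ) ^ 2) m2
                      + (a * ((L : ℝ) ^ 2)⁻¹) • blockProj L M')⁻¹
                  *ᵥ fun w => minimiser (L ^ (X.1 + 1)) (fine L M') (aK a L (X.1 + 1))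
                      (((L ^ (X.1 + 1) : ℕ) : ℝ) ^ 2) m2 (Pi.single w 1)
                      (fun μ => (((X.2.2 μ).val / L ^ n : ℕ) : ZMod (fine (L ^ (X.1 + 1)) (fine L M') μ)))))
          (fun (_ : ℕ → ℝ) (_ : PUnit)
              (X : Σ j : ℕ, Tor (fine (L ^ n * L ^ (j + 1)) (fine L M')) × Tor (fine (L ^ n * L ^ (j + 1)) (fine L M'))) =>
            (fun z => minimiser (L ^ n * L ^ (X.1 + 1)) (fine L M') (aK a L (X.1 + 1 + n))
                (((L ^ n * L ^ (X.1 + 1) : ℕ) : ℝ) ^ 2) m2 (Pi.single z 1) X.2.1)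
              ⬝ᵥ ((effLaplacian (L ^ n * L ^ (X.1 + 1)) (fine L M') (aK a L (X.1 + 1 + n))
                      (((L ^ n * L ^ (X.1 + 1) : ℕ) : ℝ) ^ 2) m2 + (a * ((L : ℝ) ^ 2)⁻¹) • blockProj L M')⁻¹
                  *ᵥ fun w => minimiser (L ^ n * L ^ (X.1 + 1)) (fine L M') (aK a L (X.1 + 1 + n))
                      (((L ^ n * L ^ (X.1 + 1) : ℕ) : ℝ) ^ 2) m2 (Pi.single w 1) X.2.2))
          W κ ((L : ℝ) ^ (-(γ / 2))) C₅ := by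
  obtain ⟨κ, C₅, hκ, hC₅, H⟩ := ne5_kingModel_threeFactor_torus hd L hLp ha hm hγ0 hγ1
  refine ⟨κ, C₅, hκ, hC₅, ?_⟩
  intro n hn M' _ hM' W
  have hLn : 0 < L ^ n := pow_pos (Nat.pos_of_ne_zero (NeZero.ne L)) n
  -- the carriers literal is repeated so that the reading maps elaborate against a closed structure
  exact H n hn (fun _ => M') (fun _ => hM')
    { Dom := Σ j : ℕ, Tor (fine (L ^ n * L ^ (j + 1)) (fine L M')) × Tor (fine (L ^ n * L ^ (j + 1)) (fine L M')),
      scale := fun X => X.1 + 1,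
      d := fun X => tdistT (fine L M')
        (blockOf (L ^ (X.1 + 1)) (fine L M')
          (fun μ => (((X.2.1 μ).val / L ^ n : ℕ) : ZMod (fine (L ^ (X.1 + 1)) (fine L M') μ))))
        (blockOf (L ^ (X.1 + 1)) (fine L M')
          (fun μ => (((X.2.2 μ).val / L ^ n : ℕ) : ZMod (fine (L ^ (X.1 + 1)) (fine L M') μ)))),
      d_nonneg := fun _ => tdistT_nonneg _ _ _,
      BgA := PUnit, BgB := PUnit, gauge := fun _ _ => 0, gauge_nonneg := fun _ _ => le_rfl, transport := id }
    (fun _ => Nat.succ_le_succ (Nat.zero_le _))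
    (fun X μ => (((X.2.1 μ).val / L ^ n : ℕ) : ZMod (fine (L ^ (X.1 + 1)) (fine L M') μ)))
    (fun X μ => (((X.2.2 μ).val / L ^ n : ℕ) : ZMod (fine (L ^ (X.1 + 1)) (fine L M') μ)))
    (fun X => X.2.1) (fun X => X.2.2)
    (fun X μ => coarse_val hLn X.2.1 μ) (fun X μ => coarse_val hLn X.2.2 μ)
    (fun _ => le_rfl) _ _ (fun _ _ _ => rfl) (fun _ _ _ => rfl) W

end Summit.QuantumFields.YangMills.BalabanUVNodes.N18KingModelTorus

end
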